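import Summits.SmoothPoincare4.SmoothPoincare4.Theorems.SullivanDualWitnessChargeV18AssemblyFacts
import Summits.SmoothPoincare4.SmoothPoincare4.Theorems.SymplecticOrigamiGromovRecognitionRelEndHelperImmersionCriterion
import Summits.SmoothPoincare4.SmoothPoincare4.Theorems.SymplecticOrigamiGromovRecognitionRelEndHelperNormalVelocityDichotomy
import Literature.Geometry.Symplectic.JSphereLocalFoliationFromTransverseFamily

/-!
# Skeleton v19 — crux `WitnessCharge` (stmt-SmoothPoincare4-7824), line `Sketch` (idea
`pencil-incompleteness`), continuation lead c9 (cycle 9, 2026-08-17)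

**Reshape of v17.** v17 (lead c8) had the single external stub
`stub_externalFacts = hls (crux 16778) ∧ adjunction (crux 16775) ∧ F5`. Since then F5 (McDuff's
no-cusp theorem) was DISCHARGED in Literature
(`jHolomorphic_immersed_of_limitEmbedded_punctured_holds`), and the route-choice seats asked for the
assembly to be re-routed around the `J`-curve half of adjunction. v18 had the two stubs
{`stub_hls`, `stub_nwtJ`}; v19 OPENS `stub_hls` (the Hofer–Lizan–Sikorav local foliation = route item
`LocalFoliationEmbeddedSpheres`, stmt-SmoothPoincare4-16778) down to its one remaining analytic input,
which the lead takes as its own stub: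

* `stub_deformationFamily` — VERBATIM the open birth stub A of crux 16778
  (`Cruxes/GromovRecognitionRelEnd/SplitLocalFoliationBirth.lean`; nobody seated on it): the
  nonlinear Fredholm core (Wendl 2018 Thm. 2.46 automatic transversality + Thm. 2.11 implicit
  function theorem, index 2) — through an embedded `J`-holomorphic two-chart sphere with trivial
  normal bundle passes a jointly smooth complex-one-parameter family of `J`-holomorphic two-chart
  spheres, effective at the linearised normal level. `stub_hls_of_deformationFamily` below is the
  sorry-free composition (copied from the birth skeleton) with the two LANDED birth stubs
  `helper_normalVelocityDichotomy` (p156261) and `helper_immersionCriterion` (p148756) and the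
  Literature reduction `hls_localFoliation_embeddedSphere_trivialNormal_of_transverseFamily`.
  Plan (line card `Lines/Sketch.md`, addendum c9): Hölder section spaces on `S²` in two charts
  (in tree: `RiemannSphereHolderSections`, layer B1) → `∂̄` on them with Cauchy-transform right
  inverses (B2) → automatic transversality `∂̄ + A` onto with 2-dim kernel by Riesz theory + the
  similarity principle (B3) → the nonlinear operator `u ↦ u_x + Ĵ(u) u_y` on
  `𝓗^{k+1,r}(TS²) × 𝓗^{k+1,r}(ℂ)` with the Hermitian exponential chart (B4) → IFT family (B5) →
  product-neighbourhood geometry + packaging (B6) → joint regularity (B7);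
* `stub_nwtJ` — `C2J`, the `J`-DECORATED normal-witness transfer: in an almost complex 4-manifold,
  an embedded `JX`-holomorphic two-chart sphere whose glued map is homotopic to that of an embedded
  `JX`-holomorphic two-chart sphere cut out by a submersion is itself cut out by a submersion.
  Implied trivially by the route item `NormalWitnessTransfer` (stmt-SmoothPoincare4-18059, the same
  statement without the `J`-holomorphy hypotheses; `helper_nwtJ_of_normalWitnessTransfer`,
  ReductionV18) and by the crux `AdjunctionEmbeddedSpheres` (stmt-16775; `helper_nwtJ_of_adjunction`).

Composition: `WitnessCharge_of := helper_witnessCharge_of_hls_nwtJ stub_hls_of_deformationFamily stub_nwtJ`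
(`Theorems/SullivanDualWitnessChargeV18AssemblyFacts.lean`, p163263: the v16 cap-chart assembly with
its one use of adjunction replaced by `C2J`, then ReductionV7 at the discharged F5). Also landed:
ReductionV18 (p163600: crux ⇐ route items 16778 ∧ 18059; `PencilLocalFamily` 16772 likewise), glue
items 16809 (p162994) and 18037 (p163633) closed.

History: v17/v16/v15 (c8) bypassed crux 16772 via the one-chart end cap; v14/v13 (c7/c6) = {L2′, F5};
v12 (c5); v7 (c4) eliminated B, U; v1–v6 (leads 0, c1, c2) landed everything else
(≈ 120 files `Theorems/SullivanDualWitnessCharge*.lean`).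
-/

noncomputable section

set_option linter.dupNamespace false

open scoped Manifold ContDiff Topology
open Set Filter Function Literature.Geometry.Symplectic Literature.Topology.FourManifolds
  Literature.Topology.FourManifolds.ComplexProjectiveSpace

namespace Summit.SmoothPoincare4.SmoothPoincare4.Theorems.WitnessCharge.PencilIncompleteness

/-- **Stub S1 — effective deformation family (the lead's stub; XL; Wendl 2018 Thm. 2.46 + Thm.
2.11, index 2).** Through an embedded `J`-holomorphic two-chart sphere with trivial normal bundle
passes a jointly smooth complex-one-parameter family of `J`-holomorphic two-chart spheres whose
normal velocity in every real direction `c ≠ 0` is not identically zero. VERBATIM the birth stub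
`stub_deformationFamily` of crux `LocalFoliationEmbeddedSpheres` (stmt-SmoothPoincare4-16778). -/
theorem stub_deformationFamily :
    ∀ (X : Type) [TopologicalSpace X] [T2Space X] [SecondCountableTopology X]
      [ChartedSpace (EuclideanSpace ℝ (Fin 4)) X] [IsManifold (𝓡 4) ∞ X]
      (JX : AlmostComplexStructure (𝓡 4) ∞ X) (u₀ v₀ : ℂ → X) (N : Set X) (πN : X → ℂ),
      ContMDiff 𝓘(ℝ, ℂ) (𝓡 4) ∞ u₀ → ContMDiff 𝓘(ℝ, ℂ) (𝓡 4) ∞ v₀ → (∀ z : ℂ, z ≠ 0 → v₀ z = u₀ z⁻¹) →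
      IsJHolomorphic (𝓡 4) (fun y => JX y) u₀ → IsJHolomorphic (𝓡 4) (fun y => JX y) v₀ →
      Injective u₀ → (∀ z, Injective (mfderiv 𝓘(ℝ, ℂ) (𝓡 4) u₀ z)) →
      Injective (mfderiv 𝓘(ℝ, ℂ) (𝓡 4) v₀ 0) → v₀ 0 ∉ range u₀ →
      IsOpen N → range u₀ ∪ {v₀ 0} ⊆ N → ContMDiffOn (𝓡 4) 𝓘(ℝ, ℂ) ∞ πN N →
      (∀ y ∈ N, Surjective (mfderiv (𝓡 4) 𝓘(ℝ, ℂ) πN y)) →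
      {y | y ∈ N ∧ πN y = 0} = range u₀ ∪ {v₀ 0} →
      ∃ (ε : ℝ) (U V : ℂ → ℂ → X), 0 < ε ∧
        (∀ z, U 0 z = u₀ z) ∧ (∀ w, V 0 w = v₀ w) ∧
        (∀ a : ℂ, ‖a‖ < ε →
          (∀ z : ℂ, z ≠ 0 → V a z = U a z⁻¹) ∧
          IsJHolomorphic (𝓡 4) (fun y => JX y) (U a) ∧ IsJHolomorphic (𝓡 4) (fun y => JX y) (V a)) ∧
        ContMDiffOn 𝓘(ℝ, ℂ × ℂ) (𝓡 4) ∞ (fun q : ℂ × ℂ => U q.1 q.2) (Metric.ball 0 ε ×ˢ univ) ∧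
        ContMDiffOn 𝓘(ℝ, ℂ × ℂ) (𝓡 4) ∞ (fun q : ℂ × ℂ => V q.1 q.2) (Metric.ball 0 ε ×ˢ univ) ∧
        (∀ c : ℂ, c ≠ 0 →
          (∃ z, (fderiv ℝ (fun a : ℂ => πN (U a z)) 0) c ≠ 0) ∨ (∃ w, (fderiv ℝ (fun a : ℂ => πN (V a w)) 0) c ≠ 0)) := by
  sorry

/-- **HLS from the deformation family** — the composition of the birth skeleton of crux 16778
(`SplitLocalFoliationBirth.LocalFoliationEmbeddedSpheres_of`), with the two LANDED birth stubs
`helper_normalVelocityDichotomy` and `helper_immersionCriterion` (crux `GromovRecognitionRelEnd`,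
leads c5/c6) and the Literature reduction `…_of_transverseFamily`: effective + dichotomy ⇒
pointwise-injective normal velocities ⇒ immersive evaluation maps ⇒ the local foliation. -/
theorem stub_hls_of_deformationFamily :
    Literature.Geometry.Symplectic.hls_localFoliation_embeddedSphere_trivialNormal := by
  refine hls_localFoliation_embeddedSphere_trivialNormal_of_transverseFamily ?_
  intro X _ _ _ _ _ JX u₀ v₀ N πN hu₀ hv₀ huv₀ hJu₀ hJv₀ hinj himm₀ himmv hnot hN hsub hπ hπs hzero
  obtain ⟨ε, U, V, hε, hU0, hV0, hleaf, hUs, hVs, heff⟩ :=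
    stub_deformationFamily X JX u₀ v₀ N πN hu₀ hv₀ huv₀ hJu₀ hJv₀ hinj himm₀ himmv hnot hN hsub
      hπ hπs hzero
  have hdich := GromovRecognitionRelEnd.CrossCapLaurent.helper_normalVelocityDichotomy X JX u₀ v₀ N
    πN hu₀ hv₀ huv₀ hJu₀ hJv₀ hinj himm₀ himmv hnot hN hsub hπ hπs hzero ε U V hε hU0 hV0 hleaf hUs hVs
  -- effective + dichotomy ⇒ every directional normal velocity is nowhere zero
  have hnz : ∀ c : ℂ, c ≠ 0 →
      (∀ z, (fderiv ℝ (fun a : ℂ => πN (U a z)) 0) c ≠ 0) ∧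
        (∀ w, (fderiv ℝ (fun a : ℂ => πN (V a w)) 0) c ≠ 0) := by
    intro c hc
    rcases hdich c with ⟨hzU, hzV⟩ | h
    · rcases heff c hc with ⟨z', hz'⟩ | ⟨w', hw'⟩
      · exact absurd (hzU z') hz'
      · exact absurd (hzV w') hw'
    · exact h
  have hDU : ∀ z, Injective (fderiv ℝ (fun a : ℂ => πN (U a z)) 0) := by
    intro z
    refine (injective_iff_map_eq_zero _).2 fun c hc0 => ?_
    by_contra hc
    exact (hnz c hc).1 z hc0
  have hDV : ∀ w, Injective (fderiv ℝ (fun a : ℂ => πN (V a w)) 0) := by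
    intro w
    refine (injective_iff_map_eq_zero _).2 fun c hc0 => ?_
    by_contra hc
    exact (hnz c hc).2 w hc0
  obtain ⟨himmU, himmV⟩ :=
    GromovRecognitionRelEnd.CrossCapLaurent.helper_immersionCriterion X JX u₀ v₀ N πN hu₀ hv₀ huv₀
      hJu₀ hJv₀ hinj himm₀ himmv hnot hN hsub hπ hπs hzero ε U V hε hU0 hV0 hleaf hUs hVs hDU hDV
  exact ⟨ε, U, V, hε, hU0, hV0, hleaf, hUs, hVs, himmU, himmV⟩

/-- **Stub S2 — `C2J`, the `J`-decorated normal-witness transfer** (classical differential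
topology: `e(ν_C) = [C]·[C]` is a homotopy invariant, `= [S]·[S] = 0`; oriented plane bundles over
`S²` with Euler number `0` are trivial; tubular neighbourhood theorem — Gompf–Stipsicz 1999 §1.2,
Milnor–Stasheff §14, Lee 2013 Thm 6.24). Closes by `exact helper_nwtJ_of_normalWitnessTransfer h`
from a proof `h` of route item 18059, or by `helper_nwtJ_of_adjunction` from crux 16775. -/
theorem stub_nwtJ :
    ∀ (X : Type) [TopologicalSpace X] [T2Space X] [SecondCountableTopology X]
      [ChartedSpace (EuclideanSpace ℝ (Fin 4)) X] [IsManifold (𝓡 4) ∞ X]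
      (JX : AlmostComplexStructure (𝓡 4) ∞ X) (u₀ v₀ : ℂ → X) (N : Set X) (π : X → ℂ)
      (u v : ℂ → X) (F F₀ : C(ComplexProjectiveSpace 1, X)),
      ContMDiff 𝓘(ℝ, ℂ) (𝓡 4) ∞ u₀ → ContMDiff 𝓘(ℝ, ℂ) (𝓡 4) ∞ v₀ → (∀ z : ℂ, z ≠ 0 → v₀ z = u₀ z⁻¹) →
      IsJHolomorphic (𝓡 4) (fun y => JX y) u₀ → IsJHolomorphic (𝓡 4) (fun y => JX y) v₀ →
      Injective u₀ → (∀ z, Injective (mfderiv 𝓘(ℝ, ℂ) (𝓡 4) u₀ z)) →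
      Injective (mfderiv 𝓘(ℝ, ℂ) (𝓡 4) v₀ 0) → v₀ 0 ∉ range u₀ →
      IsOpen N → range u₀ ∪ {v₀ 0} ⊆ N → ContMDiffOn (𝓡 4) 𝓘(ℝ, ℂ) ∞ π N →
      (∀ y ∈ N, Surjective (mfderiv (𝓡 4) 𝓘(ℝ, ℂ) π y)) →
      {y | y ∈ N ∧ π y = 0} = range u₀ ∪ {v₀ 0} →
      ContMDiff 𝓘(ℝ, ℂ) (𝓡 4) ∞ u → ContMDiff 𝓘(ℝ, ℂ) (𝓡 4) ∞ v → (∀ z : ℂ, z ≠ 0 → v z = u z⁻¹) →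
      IsJHolomorphic (𝓡 4) (fun y => JX y) u → IsJHolomorphic (𝓡 4) (fun y => JX y) v →
      Injective u → (∀ z, Injective (mfderiv 𝓘(ℝ, ℂ) (𝓡 4) u z)) →
      Injective (mfderiv 𝓘(ℝ, ℂ) (𝓡 4) v 0) → v 0 ∉ range u →
      (∀ p, CoordNeZero 0 p → F p = u (affineCoordComplex 0 p 0)) →
      (∀ p, CoordNeZero 1 p → F p = v (affineCoordComplex 1 p 0)) →
      (∀ p, CoordNeZero 0 p → F₀ p = u₀ (affineCoordComplex 0 p 0)) →
      (∀ p, CoordNeZero 1 p → F₀ p = v₀ (affineCoordComplex 1 p 0)) →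
      F.Homotopic F₀ →
      ∃ (N' : Set X) (π' : X → ℂ), IsOpen N' ∧ range u ∪ {v 0} ⊆ N' ∧
        ContMDiffOn (𝓡 4) 𝓘(ℝ, ℂ) ∞ π' N' ∧ (∀ y ∈ N', Surjective (mfderiv (𝓡 4) 𝓘(ℝ, ℂ) π' y)) ∧
        {y | y ∈ N' ∧ π' y = 0} = range u ∪ {v 0} := by
  sorry

/-- **Composition: the line closes the crux BY NAME** — `helper_witnessCharge_of_hls_nwtJ`
(V18AssemblyFacts, p163263) on `stub_hls_of_deformationFamily` and `stub_nwtJ`. -/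
theorem WitnessCharge_of : Theses.SullivanDual.WitnessCharge :=
  helper_witnessCharge_of_hls_nwtJ stub_hls_of_deformationFamily stub_nwtJ

end Summit.SmoothPoincare4.SmoothPoincare4.Theorems.WitnessCharge.PencilIncompleteness
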